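import Summits.Ventures.PercRepro.PerFlatTransfer
import Summits.Ventures.PercRepro.SixThreeRule
import Summits.Ventures.PercRepro.TheoremNAll

/-!
# PercRepro — the `(7,3)` cell: the global frame (p3, gen 15)

`Φ(7,3) = phiK 7 3 = (C(10,4) + C(10,5) + C(10,6)) / C(10,7) = 28/5` (`phiK_seven_three`), and the rank level-set
inequality `ThmN.RLS M 7 3` follows from the PER-PLANE inequality of the `θ = 6` span rule (`SixThreeRule.lean`:
`fRule`, `D`) through p2's normalised per-flat transfer (`PerFlatTransfer.c025_of_perFlat_normalized` at `q = 3`,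
where the rank-`3` flats are the planes and the normaliser is `D`): `rls_seven_three_of_perPlane`. The per-plane
inequality on a core matroid of rank `7` is the content of the cell (`P3-C025-seven-three-plan.md` §1, §8, §9 (R5)):
`t = 0` planes by Theorems P₂(7,3) / P₁(7,3), `t ∈ {1,2,3}` by the ≤ `6`-point plane types of the core.
-/

namespace PercRepro

namespace SevenThree

open Finset ThmH SixThree PerFlat

variable {α : Type} [DecidableEq α]

/-- `Φ(7,3) = 28/5`. -/
theorem phiK_seven_three : phiK 7 3 = 28 / 5 := by
  unfold phiK
  rw [show Finset.Ioo 3 7 = {4, 5, 6} from by decide]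
  rw [Finset.sum_insert (by decide), Finset.sum_insert (by decide), Finset.sum_singleton]
  norm_num [Nat.choose]

/-- **The global frame at `(7,3)`**: the per-plane inequality `(28/5)·#U_G ≤ Σ_{S ∈ Y(7,3)} f(G, S)/D(S)` on every plane
`G` gives `ThmN.RLS M 7 3`. -/
theorem rls_seven_three_of_perPlane (M : Matroid α) [M.Finite]
    (hplane : ∀ G ∈ planes M,
      (28 / 5 : ℚ) * ((UqG M 7 3 G).card : ℚ) ≤ ∑ S ∈ Yq M 7 3, fRule M G S / D M S) :
    ThmN.RLS M 7 3 := by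
  unfold ThmN.RLS
  rw [phiK_seven_three]
  apply c025_of_perFlat_normalized M 7 3 (by norm_num) (fRule M) (fRule_nonneg M)
  intro G hG
  rw [flatsQ_three] at hG
  have h := hplane G hG
  rw [flatsQ_three]
  exact h

end SevenThree

end PercRepro
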